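import Summits.HodgeConjecture.HodgeConjecture.Theses.NoetherLefschetzOneUp
import Summits.HodgeConjecture.HodgeConjecture.Theorems.NoetherLefschetzOneUpK3TypeNetsStubNetStructure
import Summits.HodgeConjecture.HodgeConjecture.Theorems.NoetherLefschetzOneUpK3TypeNetsStubFibreClassMultiple
import Summits.HodgeConjecture.HodgeConjecture.Theorems.NoetherLefschetzOneUpK3TypeNetsStubFibreClassTransport
import Literature.AlgebraicGeometry.HodgeTheory.HodgeTypeConjugation
import Literature.AlgebraicGeometry.HodgeTheory.AlgebraicClassesHodgeTypeHolds
import Literature.AlgebraicGeometry.HodgeTheory.ComplexConjugationHolds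
import Literature.AlgebraicGeometry.Motives.FiberNetExistence
import Literature.AlgebraicGeometry.Motives.SegreEmbedding
import Literature.AlgebraicGeometry.Surfaces.K3Surface
import Literature.AlgebraicGeometry.Surfaces.K3ComplexMultiplication

/-!
# Crux `K3TypeNets` (stmt-HodgeConjecture-11600) — alternative line `product_sector` (crux-strategist r1, 2026-08-17)

The crux-level form of the BC2 redirect `K3TypeNets ⇐ PgOneProductClasses ∧ (PgOneProductClasses → K3TypeNets)`
(pieces planned separately in `Lines/PgOneProductClasses_birth.lean` and `Lines/K3TypeNetsGrantedProducts_birth.lean`;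
route-level split STAGED — `split.not-final-cycle` — see `STRATEGY-CENSUS.md`): SIX registered stubs, the three of the
PRODUCT SECTOR (P1 `stub_pgZeroFactor` — theorem in print; P2 `stub_k3Pairs` — K3 × K3, the isogeny / similarity / RM core;
P3 `stub_residualPgOnePairs`) and the three NET stubs of the live v3 cut with the product sector GRANTED (S3c|P
`stub_isogenySectorGrantedProducts`, S3j|P `stub_nlRegularJumpingGrantedProducts`, S4j|P
`stub_nlIrregularJumpingGrantedProducts`), and the kernel-checked composition
`K3TypeNets_of : P1 → P2 → P3 → S3c|P → S3j|P → S4j|P → K3TypeNets` (no `sorry`; S1/S2a/S2b are the LANDED theorems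
p147213 / p147562 / p147513 used by name). PUBLISHED, NOT skeleton-registered (registering would replace the lead's live
skeleton; adoption is the lead's call at a cycle boundary — the net stubs differ from the live ones by ONE inserted hypothesis).

WHY (lead census CENSUS-c2.md §1–2): every cell of the live cut contains HC(2,2) for fourfolds dominated by `S₁ × S₂` with
`p_g(S₁) = 1` (bi-double covers / relative Kummer nets / `E_s × E'_t` nets), i.e. the K3-isogeny problem (Buskin 2019,
Huybrechts 2019, Varesco 2023; in-house stmt-13676 / 13680); here that problem is ONE place (P2/P3, with its own toolbox and
live sibling routes) instead of an unremovable resident of all three net cells.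

References: as in the two birth files (Arapura2022; VoisinHodgeII2003 Prop. 5.20; Buskin2019 Thm 1.1; Huybrechts2019 Cor. 0.4,
Rem. 3.3; Varesco2023; VanGeemen2008RM §3; MoonenZarhin1999; Markman2025SecantWeil; Green1989NLComponents; Kollar1986; Garcia2016).
-/

noncomputable section

set_option linter.dupNamespace false

open CategoryTheory AlgebraicGeometry MonoidalCategory

namespace Summit.HodgeConjecture.HodgeConjecture.Cruxes.K3TypeNets.ProductSector

open Literature.AlgebraicGeometry.Motives Literature.AlgebraicGeometry.HodgeTheory
open Literature.AlgebraicGeometry.Surfaces (IsK3Surface)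
open Summit.HodgeConjecture.HodgeConjecture.Theses.NoetherLefschetzOneUp (K3TypeNets)

/-! ## §0 The product sector (local def; the route decl `PgOneProductClasses` once the staged split lands) -/

/-- THE PRODUCT SECTOR: `HC(2,2)` for `S₁ × S₂`, `h^{2,0}(S₁) = 1`, `S₂` any smooth projective surface.
[cite: Buskin2019, Thm. 1.1] [cite: Varesco2023, Introduction] [cite: VanGeemen2008RM, §3] -/
def PgOneProductClasses : Prop :=
  ∀ ⦃S₁ S₂ : SchemeOver ℂ⦄, IsSmoothProjective 2 S₁ → IsSmoothProjective 2 S₂ →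
    (∃ A : HodgeModel 2 S₁, Module.finrank ℂ ↥(A.hodgePQ 2 2 0) = 1) →
    ∀ c : complexBetti (S₁ ⊗ S₂) (2 * 2), IsRationalClass c → IsOfHodgeType 4 (S₁ ⊗ S₂) (2 * 2) 2 2 c →
      c ∈ algebraicClasses (S₁ ⊗ S₂) 2

/-! ## §1a Product-sector stubs P1–P3 (`sorry`) -/

/-- **Stub P1 — a factor of geometric genus zero** (size L; THEOREM IN PRINT, folklore): if `p_g(S₂) = 0`
then every rational `(2,2)`-class on `S₁ × S₂` is algebraic, for ANY smooth projective surface `S₁`.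
Proof in print: `H²(S₂, ℚ) = NS(S₂)_ℚ` (no `(2,0)`-part, Lefschetz `(1,1)`); Künneth
`H⁴(S₁ × S₂) = H⁰⊗H⁴ ⊕ H¹⊗H³ ⊕ H²⊗H² ⊕ H³⊗H¹ ⊕ H⁴⊗H⁰` over `ℚ`, compatibly with Hodge types; the
`H² ⊗ NS`-component of a `(2,2)`-class is `Σ αᵢ ⊠ Dᵢ` with `αᵢ` rational `(1,1)`, hence divisors ⊠ divisors;
`H¹ ⊗ H³ = (1 ⊗ L)(H¹ ⊗ H¹)` by hard Lefschetz on `S₂` and the rational `(1,1)`-classes of `H¹ ⊗ H¹ ⊂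
H²(S₁ × S₂)` are divisor classes, whose cup with `pr₂^* L` is algebraic; `H⁰ ⊗ H⁴`, `H⁴ ⊗ H⁰` are `[S₁ × pt]`,
`[pt × S₂]`. [cite: VoisinHodgeI2002, Thm. 11.30, Thm. 11.38 and Thm. 6.25] -/
theorem stub_pgZeroFactor :
    ∀ ⦃S₁ S₂ : SchemeOver ℂ⦄, IsSmoothProjective 2 S₁ → IsSmoothProjective 2 S₂ →
      (∃ A : HodgeModel 2 S₂, Module.finrank ℂ ↥(A.hodgePQ 2 2 0) = 0) →
      ∀ c : complexBetti (S₁ ⊗ S₂) (2 * 2), IsRationalClass c → IsOfHodgeType 4 (S₁ ⊗ S₂) (2 * 2) 2 2 c →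
        c ∈ algebraicClasses (S₁ ⊗ S₂) 2 := by
  sorry

/-- **Stub P2 — K3 pairs** (size XL; the OPEN CORE): for K3 surfaces `S₁`, `S₂` every rational `(2,2)`-class on
`S₁ × S₂` is algebraic. Equivalently (Künneth + Lefschetz `(1,1)` + `[pt × S]`, `[S × pt]`): every Hodge
morphism `T(S₂)_ℚ → T(S₁)_ℚ` of the transcendental lattices is induced by an algebraic class. Known:
Hodge ISOMETRIES (Mukai, Nikulin, Buskin 2019 Thm. 1.1 — tree fact `Buskin2019_hodgeIsometry_algebraic`),
hence `S₁ = S₂` with `End_Hdg(T) ∈ {ℚ, CM field}` (Huybrechts 2019 Cor. 0.4; tree fact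
`Buskin2019_hodgeConjectureFor_square_of_CM`); open: similarities of non-square multiplier (in-house
stmt-13676) and real multiplication (`√2` beyond the Nikulin locus: stmt-13680; general totally real `E`).
[cite: Buskin2019, Thm. 1.1] [cite: Huybrechts2019, Cor. 0.4 and Rem. 3.3] [cite: Varesco2023, Introduction and Thm. 2.1] -/
theorem stub_k3Pairs :
    ∀ ⦃S₁ S₂ : SchemeOver ℂ⦄, IsK3Surface S₁ → IsK3Surface S₂ →
      ∀ c : complexBetti (S₁ ⊗ S₂) (2 * 2), IsRationalClass c → IsOfHodgeType 4 (S₁ ⊗ S₂) (2 * 2) 2 2 c →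
        c ∈ algebraicClasses (S₁ ⊗ S₂) 2 := by
  sorry

/-- **Stub P3 — the residual genus-one pairs** (size XL; open): `p_g(S₁) = 1`, `p_g(S₂) ≥ 1`, NOT both K3:
products of abelian surfaces (they contain the Weil-type abelian fourfolds `B × B`, Moonen–Zarhin 1999;
algebraic for special discriminants only — Schoen 1988, Markman 2025), K3 × abelian surface (the Kummer /
Shioda–Inose correspondence `T(A) ≅ T(Km A)` is algebraic and reduces to P2-type morphisms), K3 × surfaces
with `p_g ≥ 2` (`Hom_Hdg(T(S₂), T(S₁))` — the bi-double-cover classes of the crux), and the non-K3 regular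
`p_g = 1` surfaces (Kynev–Todorov). HC-implied. [cite: MoonenZarhin1999, §0]
[cite: Markman2025SecantWeil, Thm. 1.1] [cite: Varesco2023, Introduction] -/
theorem stub_residualPgOnePairs :
    ∀ ⦃S₁ S₂ : SchemeOver ℂ⦄, IsSmoothProjective 2 S₁ → IsSmoothProjective 2 S₂ →
      (∃ A : HodgeModel 2 S₁, Module.finrank ℂ ↥(A.hodgePQ 2 2 0) = 1) →
      (∃ A : HodgeModel 2 S₂, Module.finrank ℂ ↥(A.hodgePQ 2 2 0) ≠ 0) →
      ¬ (IsK3Surface S₁ ∧ IsK3Surface S₂) →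
      ∀ c : complexBetti (S₁ ⊗ S₂) (2 * 2), IsRationalClass c → IsOfHodgeType 4 (S₁ ⊗ S₂) (2 * 2) 2 2 c →
        c ∈ algebraicClasses (S₁ ⊗ S₂) 2 := by
  sorry

/-! ## §1b Net stubs granted the product sector: S3c|P, S3j|P, S4j|P (`sorry`); S1/S2a/S2b are LANDED -/

/-- **Stub S3c|P — the ISOGENY sector granted products** (L/XL; closable for K3/abelian fibres). The live
`stub_isogenySector` (K3-type net, non-empty smooth open `U`, fibres over `U(ℂ)` smooth projective with
`h^{2,0} = 1`, ALL with the same Picard number; a fibre-trivial rational `(2,2)`-class is `a + (c - a)`, `a`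
rational algebraic, `c - a` supported over a proper closed `C ⊊ ℙ²`) with the product sector P as an extra
hypothesis. Plan: constant Picard number ⇒ period map constant (Green / Voisin II 5.20 backwards) ⇒ finite
monodromy, isotrivial for Torelli fibres ⇒ `X` dominated by `X_{s₀} × B'` ⇒ P + blow-up formula +
`g_* g^* = deg g`. HC-implied (`a := c`, `C := ∅`). [cite: VoisinHodgeII2003, Prop. 5.20]
[cite: Buskin2019, Thm. 1.1] [cite: Huybrechts2019, Rem. 3.3] -/
theorem stub_isogenySectorGrantedProducts :
    PgOneProductClasses →
    ∀ ⦃X : SchemeOver ℂ⦄ (f : X ⟶ projectiveSpace 2 ℂ), IsSmoothProjective 4 X →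
      Function.Surjective f.left.base → GeometricallyConnected f.left →
      (∀ U : (projectiveSpace 2 ℂ).left.Opens,
        Smooth (f.left ∣_ U) → SmoothOfRelativeDimension 2 (f.left ∣_ U)) →
      ∀ U : (projectiveSpace 2 ℂ).left.Opens, U ≠ ⊥ → Smooth (f.left ∣_ U) →
        (∀ s : AlgPoints (projectiveSpace 2 ℂ) ℂ, s.pt ∈ U →
          IsSmoothProjective 2 (fiberOver f s) ∧
            ∃ A : HodgeModel 2 (fiberOver f s), Module.finrank ℂ ↥(A.hodgePQ 2 2 0) = 1) →
        (∀ s t : AlgPoints (projectiveSpace 2 ℂ) ℂ, s.pt ∈ U → t.pt ∈ U →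
          Module.finrank ℂ ↥(Submodule.span ℂ {x : complexBetti (fiberOver f s) (2 * 1) |
              IsRationalClass x ∧ IsOfHodgeType 2 (fiberOver f s) (2 * 1) 1 1 x}) =
            Module.finrank ℂ ↥(Submodule.span ℂ {x : complexBetti (fiberOver f t) (2 * 1) |
              IsRationalClass x ∧ IsOfHodgeType 2 (fiberOver f t) (2 * 1) 1 1 x})) →
        ∀ c : complexBetti X (2 * 2), IsRationalClass c → IsOfHodgeType 4 X (2 * 2) 2 2 c →
          (∀ s : AlgPoints (projectiveSpace 2 ℂ) ℂ, s.pt ∈ U →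
            complexBetti.map (fiberι f s) (2 * 2) c = 0) →
          ∃ a : complexBetti X (2 * 2), IsRationalClass a ∧ a ∈ algebraicClasses X 2 ∧
            ∃ C : Set (projectiveSpace 2 ℂ).left, IsClosed C ∧ C ≠ Set.univ ∧
              complexBetti.restrictCompl X (f.left.base ⁻¹' C) (2 * 2) (c - a) = 0 := by
  sorry

/-- **Stub S3j|P — NL support, REGULAR fibres, JUMPING Picard number, granted products** (XL — the heart of
the route's mechanism). The live `stub_nlSupportRegularJumping` with P as an extra hypothesis: the relative
Kummer nets `Km(E_s × E'_t)` (CENSUS-c2 §1) are discharged by P; what remains is the Noether–Lefschetz thesis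
for nets with non-constant period map that are not product-dominated (NL-Gysin classes over the dense NL
curves + multisections span the fibre-trivial Hodge classes modulo vertical ones; bi-type `(1,1)_B ⊗ (1,1)_𝕋`
by Kollár's vanishing over `ℙ²`; theta-series audit). HC-implied. [cite: Arapura2022, Cor. 1.4 and Rmk. 1.6]
[cite: Green1989NLComponents] [cite: Kollar1986, Thm. 2.1] [cite: Garcia2016, Thm. 1.2] -/
theorem stub_nlRegularJumpingGrantedProducts :
    PgOneProductClasses →
    ∀ ⦃X : SchemeOver ℂ⦄ (f : X ⟶ projectiveSpace 2 ℂ), IsSmoothProjective 4 X →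
      Function.Surjective f.left.base → GeometricallyConnected f.left →
      (∀ U : (projectiveSpace 2 ℂ).left.Opens,
        Smooth (f.left ∣_ U) → SmoothOfRelativeDimension 2 (f.left ∣_ U)) →
      ∀ U : (projectiveSpace 2 ℂ).left.Opens, U ≠ ⊥ → Smooth (f.left ∣_ U) →
        (∀ s : AlgPoints (projectiveSpace 2 ℂ) ℂ, s.pt ∈ U →
          IsSmoothProjective 2 (fiberOver f s) ∧
            ∃ A : HodgeModel 2 (fiberOver f s), Module.finrank ℂ ↥(A.hodgePQ 2 2 0) = 1) →
        (∀ s : AlgPoints (projectiveSpace 2 ℂ) ℂ, s.pt ∈ U →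
          ∀ A : HodgeModel 2 (fiberOver f s), Module.finrank ℂ ↥(A.hodgePQ 1 1 0) = 0) →
        (∃ s t : AlgPoints (projectiveSpace 2 ℂ) ℂ, s.pt ∈ U ∧ t.pt ∈ U ∧
          Module.finrank ℂ ↥(Submodule.span ℂ {x : complexBetti (fiberOver f s) (2 * 1) |
              IsRationalClass x ∧ IsOfHodgeType 2 (fiberOver f s) (2 * 1) 1 1 x}) ≠
            Module.finrank ℂ ↥(Submodule.span ℂ {x : complexBetti (fiberOver f t) (2 * 1) |
              IsRationalClass x ∧ IsOfHodgeType 2 (fiberOver f t) (2 * 1) 1 1 x})) →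
        ∀ c : complexBetti X (2 * 2), IsRationalClass c → IsOfHodgeType 4 X (2 * 2) 2 2 c →
          (∀ s : AlgPoints (projectiveSpace 2 ℂ) ℂ, s.pt ∈ U →
            complexBetti.map (fiberι f s) (2 * 2) c = 0) →
          ∃ a : complexBetti X (2 * 2), IsRationalClass a ∧ a ∈ algebraicClasses X 2 ∧
            ∃ C : Set (projectiveSpace 2 ℂ).left, IsClosed C ∧ C ≠ Set.univ ∧
              complexBetti.restrictCompl X (f.left.base ⁻¹' C) (2 * 2) (c - a) = 0 := by
  sorry

/-- **Stub S4j|P — NL support, IRREGULAR fibres, JUMPING Picard number, granted products** (XL). The live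
`stub_nlSupportIrregularJumping` with P as an extra hypothesis: the refuter's `E_s × E'_t` nets on
`Bl(S × S')` (RM / similarity classes in `T(S) ⊗ T(S')`) are discharged by P; residue: genuinely
two-parameter abelian-surface (and `q = 1`, `p_g = 1`) nets, Humbert curves as NL curves, Mordell–Weil supply
of `H¹(U, R³)`. HC-implied. [cite: Arapura2022, Cor. 1.4] [cite: VanGeemen2008RM, §3] [cite: Zucker1977] -/
theorem stub_nlIrregularJumpingGrantedProducts :
    PgOneProductClasses →
    ∀ ⦃X : SchemeOver ℂ⦄ (f : X ⟶ projectiveSpace 2 ℂ), IsSmoothProjective 4 X →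
      Function.Surjective f.left.base → GeometricallyConnected f.left →
      (∀ U : (projectiveSpace 2 ℂ).left.Opens,
        Smooth (f.left ∣_ U) → SmoothOfRelativeDimension 2 (f.left ∣_ U)) →
      ∀ U : (projectiveSpace 2 ℂ).left.Opens, U ≠ ⊥ → Smooth (f.left ∣_ U) →
        (∀ s : AlgPoints (projectiveSpace 2 ℂ) ℂ, s.pt ∈ U →
          IsSmoothProjective 2 (fiberOver f s) ∧
            ∃ A : HodgeModel 2 (fiberOver f s), Module.finrank ℂ ↥(A.hodgePQ 2 2 0) = 1) →
        (∃ s : AlgPoints (projectiveSpace 2 ℂ) ℂ, s.pt ∈ U ∧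
          ∃ A : HodgeModel 2 (fiberOver f s), Module.finrank ℂ ↥(A.hodgePQ 1 1 0) ≠ 0) →
        (∃ s t : AlgPoints (projectiveSpace 2 ℂ) ℂ, s.pt ∈ U ∧ t.pt ∈ U ∧
          Module.finrank ℂ ↥(Submodule.span ℂ {x : complexBetti (fiberOver f s) (2 * 1) |
              IsRationalClass x ∧ IsOfHodgeType 2 (fiberOver f s) (2 * 1) 1 1 x}) ≠
            Module.finrank ℂ ↥(Submodule.span ℂ {x : complexBetti (fiberOver f t) (2 * 1) |
              IsRationalClass x ∧ IsOfHodgeType 2 (fiberOver f t) (2 * 1) 1 1 x})) →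
        ∀ c : complexBetti X (2 * 2), IsRationalClass c → IsOfHodgeType 4 X (2 * 2) 2 2 c →
          (∀ s : AlgPoints (projectiveSpace 2 ℂ) ℂ, s.pt ∈ U →
            complexBetti.map (fiberι f s) (2 * 2) c = 0) →
          ∃ a : complexBetti X (2 * 2), IsRationalClass a ∧ a ∈ algebraicClasses X 2 ∧
            ∃ C : Set (projectiveSpace 2 ℂ).left, IsClosed C ∧ C ≠ Set.univ ∧
              complexBetti.restrictCompl X (f.left.base ⁻¹' C) (2 * 2) (c - a) = 0 := by
  sorry

/-! ## §2 Name-keyed statements of the six stubs (verbatim) -/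

namespace Registered


/-- Statement of `stub_pgZeroFactor`, verbatim. -/
abbrev stub_pgZeroFactor : Prop :=
  ∀ ⦃S₁ S₂ : SchemeOver ℂ⦄, IsSmoothProjective 2 S₁ → IsSmoothProjective 2 S₂ →
    (∃ A : HodgeModel 2 S₂, Module.finrank ℂ ↥(A.hodgePQ 2 2 0) = 0) →
    ∀ c : complexBetti (S₁ ⊗ S₂) (2 * 2), IsRationalClass c → IsOfHodgeType 4 (S₁ ⊗ S₂) (2 * 2) 2 2 c →
      c ∈ algebraicClasses (S₁ ⊗ S₂) 2

/-- Statement of `stub_k3Pairs`, verbatim. -/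
abbrev stub_k3Pairs : Prop :=
  ∀ ⦃S₁ S₂ : SchemeOver ℂ⦄, IsK3Surface S₁ → IsK3Surface S₂ →
    ∀ c : complexBetti (S₁ ⊗ S₂) (2 * 2), IsRationalClass c → IsOfHodgeType 4 (S₁ ⊗ S₂) (2 * 2) 2 2 c →
      c ∈ algebraicClasses (S₁ ⊗ S₂) 2

/-- Statement of `stub_residualPgOnePairs`, verbatim. -/
abbrev stub_residualPgOnePairs : Prop :=
  ∀ ⦃S₁ S₂ : SchemeOver ℂ⦄, IsSmoothProjective 2 S₁ → IsSmoothProjective 2 S₂ →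
    (∃ A : HodgeModel 2 S₁, Module.finrank ℂ ↥(A.hodgePQ 2 2 0) = 1) →
    (∃ A : HodgeModel 2 S₂, Module.finrank ℂ ↥(A.hodgePQ 2 2 0) ≠ 0) →
    ¬ (IsK3Surface S₁ ∧ IsK3Surface S₂) →
    ∀ c : complexBetti (S₁ ⊗ S₂) (2 * 2), IsRationalClass c → IsOfHodgeType 4 (S₁ ⊗ S₂) (2 * 2) 2 2 c →
      c ∈ algebraicClasses (S₁ ⊗ S₂) 2



/-- Statement of `stub_isogenySectorGrantedProducts`, verbatim. -/
abbrev stub_isogenySectorGrantedProducts : Prop :=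
  PgOneProductClasses →
  ∀ ⦃X : SchemeOver ℂ⦄ (f : X ⟶ projectiveSpace 2 ℂ), IsSmoothProjective 4 X →
    Function.Surjective f.left.base → GeometricallyConnected f.left →
    (∀ U : (projectiveSpace 2 ℂ).left.Opens,
      Smooth (f.left ∣_ U) → SmoothOfRelativeDimension 2 (f.left ∣_ U)) →
    ∀ U : (projectiveSpace 2 ℂ).left.Opens, U ≠ ⊥ → Smooth (f.left ∣_ U) →
      (∀ s : AlgPoints (projectiveSpace 2 ℂ) ℂ, s.pt ∈ U →
        IsSmoothProjective 2 (fiberOver f s) ∧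
          ∃ A : HodgeModel 2 (fiberOver f s), Module.finrank ℂ ↥(A.hodgePQ 2 2 0) = 1) →
      (∀ s t : AlgPoints (projectiveSpace 2 ℂ) ℂ, s.pt ∈ U → t.pt ∈ U →
        Module.finrank ℂ ↥(Submodule.span ℂ {x : complexBetti (fiberOver f s) (2 * 1) |
            IsRationalClass x ∧ IsOfHodgeType 2 (fiberOver f s) (2 * 1) 1 1 x}) =
          Module.finrank ℂ ↥(Submodule.span ℂ {x : complexBetti (fiberOver f t) (2 * 1) |
            IsRationalClass x ∧ IsOfHodgeType 2 (fiberOver f t) (2 * 1) 1 1 x})) →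
      ∀ c : complexBetti X (2 * 2), IsRationalClass c → IsOfHodgeType 4 X (2 * 2) 2 2 c →
        (∀ s : AlgPoints (projectiveSpace 2 ℂ) ℂ, s.pt ∈ U →
          complexBetti.map (fiberι f s) (2 * 2) c = 0) →
        ∃ a : complexBetti X (2 * 2), IsRationalClass a ∧ a ∈ algebraicClasses X 2 ∧
          ∃ C : Set (projectiveSpace 2 ℂ).left, IsClosed C ∧ C ≠ Set.univ ∧
            complexBetti.restrictCompl X (f.left.base ⁻¹' C) (2 * 2) (c - a) = 0

/-- Statement of `stub_nlRegularJumpingGrantedProducts`, verbatim. -/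
abbrev stub_nlRegularJumpingGrantedProducts : Prop :=
  PgOneProductClasses →
  ∀ ⦃X : SchemeOver ℂ⦄ (f : X ⟶ projectiveSpace 2 ℂ), IsSmoothProjective 4 X →
    Function.Surjective f.left.base → GeometricallyConnected f.left →
    (∀ U : (projectiveSpace 2 ℂ).left.Opens,
      Smooth (f.left ∣_ U) → SmoothOfRelativeDimension 2 (f.left ∣_ U)) →
    ∀ U : (projectiveSpace 2 ℂ).left.Opens, U ≠ ⊥ → Smooth (f.left ∣_ U) →
      (∀ s : AlgPoints (projectiveSpace 2 ℂ) ℂ, s.pt ∈ U →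
        IsSmoothProjective 2 (fiberOver f s) ∧
          ∃ A : HodgeModel 2 (fiberOver f s), Module.finrank ℂ ↥(A.hodgePQ 2 2 0) = 1) →
      (∀ s : AlgPoints (projectiveSpace 2 ℂ) ℂ, s.pt ∈ U →
        ∀ A : HodgeModel 2 (fiberOver f s), Module.finrank ℂ ↥(A.hodgePQ 1 1 0) = 0) →
      (∃ s t : AlgPoints (projectiveSpace 2 ℂ) ℂ, s.pt ∈ U ∧ t.pt ∈ U ∧
        Module.finrank ℂ ↥(Submodule.span ℂ {x : complexBetti (fiberOver f s) (2 * 1) |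
            IsRationalClass x ∧ IsOfHodgeType 2 (fiberOver f s) (2 * 1) 1 1 x}) ≠
          Module.finrank ℂ ↥(Submodule.span ℂ {x : complexBetti (fiberOver f t) (2 * 1) |
            IsRationalClass x ∧ IsOfHodgeType 2 (fiberOver f t) (2 * 1) 1 1 x})) →
      ∀ c : complexBetti X (2 * 2), IsRationalClass c → IsOfHodgeType 4 X (2 * 2) 2 2 c →
        (∀ s : AlgPoints (projectiveSpace 2 ℂ) ℂ, s.pt ∈ U →
          complexBetti.map (fiberι f s) (2 * 2) c = 0) →
        ∃ a : complexBetti X (2 * 2), IsRationalClass a ∧ a ∈ algebraicClasses X 2 ∧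
          ∃ C : Set (projectiveSpace 2 ℂ).left, IsClosed C ∧ C ≠ Set.univ ∧
            complexBetti.restrictCompl X (f.left.base ⁻¹' C) (2 * 2) (c - a) = 0

/-- Statement of `stub_nlIrregularJumpingGrantedProducts`, verbatim. -/
abbrev stub_nlIrregularJumpingGrantedProducts : Prop :=
  PgOneProductClasses →
  ∀ ⦃X : SchemeOver ℂ⦄ (f : X ⟶ projectiveSpace 2 ℂ), IsSmoothProjective 4 X →
    Function.Surjective f.left.base → GeometricallyConnected f.left →
    (∀ U : (projectiveSpace 2 ℂ).left.Opens,
      Smooth (f.left ∣_ U) → SmoothOfRelativeDimension 2 (f.left ∣_ U)) →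
    ∀ U : (projectiveSpace 2 ℂ).left.Opens, U ≠ ⊥ → Smooth (f.left ∣_ U) →
      (∀ s : AlgPoints (projectiveSpace 2 ℂ) ℂ, s.pt ∈ U →
        IsSmoothProjective 2 (fiberOver f s) ∧
          ∃ A : HodgeModel 2 (fiberOver f s), Module.finrank ℂ ↥(A.hodgePQ 2 2 0) = 1) →
      (∃ s : AlgPoints (projectiveSpace 2 ℂ) ℂ, s.pt ∈ U ∧
        ∃ A : HodgeModel 2 (fiberOver f s), Module.finrank ℂ ↥(A.hodgePQ 1 1 0) ≠ 0) →
      (∃ s t : AlgPoints (projectiveSpace 2 ℂ) ℂ, s.pt ∈ U ∧ t.pt ∈ U ∧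
        Module.finrank ℂ ↥(Submodule.span ℂ {x : complexBetti (fiberOver f s) (2 * 1) |
            IsRationalClass x ∧ IsOfHodgeType 2 (fiberOver f s) (2 * 1) 1 1 x}) ≠
          Module.finrank ℂ ↥(Submodule.span ℂ {x : complexBetti (fiberOver f t) (2 * 1) |
            IsRationalClass x ∧ IsOfHodgeType 2 (fiberOver f t) (2 * 1) 1 1 x})) →
      ∀ c : complexBetti X (2 * 2), IsRationalClass c → IsOfHodgeType 4 X (2 * 2) 2 2 c →
        (∀ s : AlgPoints (projectiveSpace 2 ℂ) ℂ, s.pt ∈ U →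
          complexBetti.map (fiberι f s) (2 * 2) c = 0) →
        ∃ a : complexBetti X (2 * 2), IsRationalClass a ∧ a ∈ algebraicClasses X 2 ∧
          ∃ C : Set (projectiveSpace 2 ℂ).left, IsClosed C ∧ C ≠ Set.univ ∧
            complexBetti.restrictCompl X (f.left.base ⁻¹' C) (2 * 2) (c - a) = 0

end Registered

/-! ## §3 Compositions (no `sorry` from here on) -/

theorem PgOneProductClasses_of (h₁ : Registered.stub_pgZeroFactor) (h₂ : Registered.stub_k3Pairs)
    (h₃ : Registered.stub_residualPgOnePairs) : PgOneProductClasses := by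
  intro S₁ S₂ hS₁ hS₂ hpg c hc hpp
  by_cases hz : ∃ A : HodgeModel 2 S₂, Module.finrank ℂ ↥(A.hodgePQ 2 2 0) = 0
  · -- a factor of geometric genus zero: theorem in print
    exact h₁ hS₁ hS₂ hz c hc hpp
  · -- `p_g(S₂) ≥ 1` on SOME (hence every) Hodge model, which exists unconditionally
    have hpos : ∃ A : HodgeModel 2 S₂, Module.finrank ℂ ↥(A.hodgePQ 2 2 0) ≠ 0 := by
      obtain ⟨A⟩ := nonempty_hodgeModel_holds (n := 2) (X := S₂) hS₂
      push Not at hz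
      exact ⟨A, hz A⟩
    by_cases hK3 : IsK3Surface S₁ ∧ IsK3Surface S₂
    · -- the K3 × K3 core
      exact h₂ hK3.1 hK3.2 c hc hpp
    · -- the residual genus-one pairs
      exact h₃ hS₁ hS₂ hpg hpos hK3 c hc hpp



/-- Rational classes are stable under differences (from `IsRationalClass.add/.smul`; the tree's
`IsRationalClass.sub'` lives in a heavier file). [cite: HatcherAT2002, §3.1] -/
theorem isRationalClass_sub {Y : Type} [TopologicalSpace Y] {k : ℕ}
    {c c' : Literature.AlgebraicTopology.SingularHomology.singularCohomology ℂ ℂ Y k}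
    (hc : IsRationalClass c) (hc' : IsRationalClass c') : IsRationalClass (c - c') := by
  have h := hc.add (hc'.smul (-1))
  rwa [Rat.cast_neg, Rat.cast_one, neg_one_smul, ← sub_eq_add_neg] at h

/-- **Two non-empty opens of `ℙ²_ℂ` meet** (`ℙ²` is irreducible: smooth projective varieties are
geometrically irreducible, `IsSmoothProjective.isIntegral_holds`). [folklore] -/
theorem inf_ne_bot_of_projectiveSpace {V W : (projectiveSpace 2 ℂ).left.Opens}
    (hV : (V : Set (projectiveSpace 2 ℂ).left).Nonempty)
    (hW : (W : Set (projectiveSpace 2 ℂ).left).Nonempty) : V ⊓ W ≠ ⊥ := by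
  haveI : IsIntegral (projectiveSpace 2 ℂ).left :=
    IsSmoothProjective.isIntegral_holds (isSmoothProjective_projectiveSpace_holds ℂ 2)
  rw [ne_eq, ← TopologicalSpace.Opens.coe_eq_empty, TopologicalSpace.Opens.coe_inf, ← ne_eq,
    ← Set.nonempty_iff_ne_empty]
  exact nonempty_preirreducible_inter V.isOpen W.isOpen hV hW

/-- **`PgOneProductClasses → K3TypeNets` from the three net stubs** (kernel-checked, no `sorry`; verbatim
the live composition `K3TypeNets_of` of `Cruxes/K3TypeNets/Lines/birth.lean` v3 after `intro hP`, the granted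
product sector `hP` being handed to each cell): S1 (landed) ⇒ tautological surface net `N`, smooth open
`U := Tᶜ ⊓ N.smoothBase ≠ ⊥`; `span_le`; S2a (landed) calibrates `c` by a rational multiple of the
multisection class `σ` on one fibre, S2b (landed, Ehresmann) transports fibre-triviality over `U(ℂ)`;
`by_cases` Picard-constancy (S3c|P), else `by_cases` regularity (S3j|P / S4j|P); reassemble
`c = (q σ + a) + (c - q σ - a) ∈ algebraicClasses X 2 ⊔ V_f`. [cite: Arapura2022, Cor. 1.4 and Rmk. 1.6]
[cite: VoisinHodgeII2003, §4.3 and Prop. 5.20] -/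
theorem k3TypeNets_of_pgOneProductClasses (h₃ : Registered.stub_isogenySectorGrantedProducts)
    (h₄ : Registered.stub_nlRegularJumpingGrantedProducts)
    (h₅ : Registered.stub_nlIrregularJumpingGrantedProducts) :
    PgOneProductClasses → K3TypeNets := by
  -- the product sector is GRANTED: hand it to every cell
  intro hP
  -- the three LANDED stubs (S1, S2a, S2b) are discharged inside the proof, by name
  have h₁ := Summit.HodgeConjecture.HodgeConjecture.Theorems.stub_netStructure
  have h₂ := Summit.HodgeConjecture.HodgeConjecture.Theorems.stub_fibreClassMultiple
  have h₂' := Summit.HodgeConjecture.HodgeConjecture.Theorems.stub_fibreClassTransport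
  intro X f hX hf hT
  obtain ⟨T, hTc, hTu, hfib⟩ := hT
  -- S1: the fibration is a surface net (connected fibres, relative dimension two where smooth)
  obtain ⟨hconn, hrel⟩ := h₁ f hX hf ⟨T, hTc, hTu, fun s hs ↦ (hfib s hs).1⟩
  haveI := hconn
  -- the tautological surface net and the smooth open `U := Tᶜ ⊓ smoothBase`
  let N : SurfaceNet 2 X := SurfaceNet.ofFibration (m := 2) hX f hrel
  let U : (projectiveSpace 2 ℂ).left.Opens := ⟨Tᶜ, hTc.isOpen_compl⟩ ⊓ N.smoothBase
  have hUT : ∀ s : AlgPoints (projectiveSpace 2 ℂ) ℂ, s.pt ∈ U → s.pt ∉ T :=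
    fun s hs ↦ (TopologicalSpace.Opens.mem_inf.mp hs).1
  have hUne : U ≠ ⊥ :=
    inf_ne_bot_of_projectiveSpace (Set.nonempty_compl.mpr hTu) N.smoothBase_nonempty_of_charZero
  haveI : LocallyOfFinitePresentation f.left := N.locallyOfFinitePresentation_proj
  have hUs : Smooth (f.left ∣_ U) :=
    Literature.AlgebraicGeometry.Morphisms.smooth_morphismRestrict_of_preimage_le_smoothLocus
      f.left U fun x hx ↦ N.preimage_smoothBase_le_smoothLocus
        (show x ∈ N.proj.left ⁻¹ᵁ N.smoothBase from (TopologicalSpace.Opens.mem_inf.mp hx).2)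
  have hfibU : ∀ s : AlgPoints (projectiveSpace 2 ℂ) ℂ, s.pt ∈ U →
      IsSmoothProjective 2 (fiberOver f s) ∧
        ∃ A : HodgeModel 2 (fiberOver f s), Module.finrank ℂ ↥(A.hodgePQ 2 2 0) = 1 :=
    fun s hs ↦ hfib s (hUT s hs)
  refine Submodule.span_le.mpr ?_
  rintro c ⟨hcQ, hcH⟩
  -- S2a: the multisection class `σ` and the fibrewise rational multiple
  obtain ⟨σ, hσQ, hσA, hmult⟩ := h₂ f hX
  have hσH : IsOfHodgeType 4 X (2 * 2) 2 2 σ :=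
    isOfHodgeType_of_mem_algebraicClasses_of_isSmoothProjective hX 2 hσA
  -- S2a at one point of `U(ℂ)`, transported over `U(ℂ)` by S2b
  obtain ⟨q, hq⟩ : ∃ q : ℚ, ∀ s : AlgPoints (projectiveSpace 2 ℂ) ℂ, s.pt ∈ U →
      complexBetti.map (fiberι f s) (2 * 2) (c - (q : ℂ) • σ) = 0 := by
    by_cases hne : ∃ s₀ : AlgPoints (projectiveSpace 2 ℂ) ℂ, s₀.pt ∈ U
    · obtain ⟨s₀, hs₀⟩ := hne
      obtain ⟨q, hq₀⟩ := hmult s₀ (hfibU s₀ hs₀).1 c hcQ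
      exact ⟨q, fun s hs ↦ h₂' f hX hconn hrel U hUs _ s₀ s hs₀ hs hq₀⟩
    · push Not at hne
      exact ⟨0, fun s hs ↦ (hne s hs).elim⟩
  have hc'Q : IsRationalClass (c - (q : ℂ) • σ) := isRationalClass_sub hcQ (hσQ.smul q)
  have hc'H : IsOfHodgeType 4 X (2 * 2) 2 2 (c - (q : ℂ) • σ) := hcH.sub hX (hσH.smul _)
  -- S3c / S3j / S4j: a fibre-trivial Hodge class is a multisection combination plus a class supported
  -- over a curve — by the Picard dichotomy, then by regularity
  have key : ∃ a : complexBetti X (2 * 2), IsRationalClass a ∧ a ∈ algebraicClasses X 2 ∧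
      ∃ C : Set (projectiveSpace 2 ℂ).left, IsClosed C ∧ C ≠ Set.univ ∧
        complexBetti.restrictCompl X (f.left.base ⁻¹' C) (2 * 2) (c - (q : ℂ) • σ - a) = 0 := by
    by_cases hconst : ∀ s t : AlgPoints (projectiveSpace 2 ℂ) ℂ, s.pt ∈ U → t.pt ∈ U →
        Module.finrank ℂ ↥(Submodule.span ℂ {x : complexBetti (fiberOver f s) (2 * 1) |
            IsRationalClass x ∧ IsOfHodgeType 2 (fiberOver f s) (2 * 1) 1 1 x}) =
          Module.finrank ℂ ↥(Submodule.span ℂ {x : complexBetti (fiberOver f t) (2 * 1) |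
            IsRationalClass x ∧ IsOfHodgeType 2 (fiberOver f t) (2 * 1) 1 1 x})
    · -- the isogeny sector
      exact h₃ hP f hX hf hconn hrel U hUne hUs hfibU hconst _ hc'Q hc'H hq
    · -- the Noether–Lefschetz sector
      push Not at hconst
      obtain ⟨s₁, t₁, hs₁, ht₁, hne₁⟩ := hconst
      by_cases hreg : ∀ s : AlgPoints (projectiveSpace 2 ℂ) ℂ, s.pt ∈ U →
          ∀ A : HodgeModel 2 (fiberOver f s), Module.finrank ℂ ↥(A.hodgePQ 1 1 0) = 0
      · exact h₄ hP f hX hf hconn hrel U hUne hUs hfibU hreg ⟨s₁, t₁, hs₁, ht₁, hne₁⟩ _ hc'Q hc'H hq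
      · push Not at hreg
        exact h₅ hP f hX hf hconn hrel U hUne hUs hfibU hreg ⟨s₁, t₁, hs₁, ht₁, hne₁⟩ _ hc'Q hc'H hq
  obtain ⟨a, haQ, haA, C, hCc, hCu, hCa⟩ := key
  have haH : IsOfHodgeType 4 X (2 * 2) 2 2 a :=
    isOfHodgeType_of_mem_algebraicClasses_of_isSmoothProjective hX 2 haA
  -- the residual class is VERTICAL: a generator of the route's `V_f`
  have hv : c - (q : ℂ) • σ - a ∈ Submodule.span ℂ {c : complexBetti X (2 * 2) |
      IsRationalClass c ∧ IsOfHodgeType 4 X (2 * 2) 2 2 c ∧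
        ∃ T : Set (projectiveSpace 2 ℂ).left, IsClosed T ∧ T ≠ Set.univ ∧
          complexBetti.restrictCompl X (f.left.base ⁻¹' T) (2 * 2) c = 0} :=
    Submodule.subset_span ⟨isRationalClass_sub hc'Q haQ, hc'H.sub hX haH, C, hCc, hCu, hCa⟩
  -- reassemble `c = (q • σ + a) + (c - q • σ - a)` : algebraic ⊔ vertical
  have hdecomp : c = ((q : ℂ) • σ + a) + (c - (q : ℂ) • σ - a) := by abel
  rw [hdecomp]
  exact Submodule.add_mem _
    (Submodule.mem_sup_left (Submodule.add_mem _ (Submodule.smul_mem _ _ hσA) haA))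
    (Submodule.mem_sup_right hv)

/-- **The crux `K3TypeNets` from the six stubs** (kernel-checked, no `sorry`): the product sector from P1–P3, then the
net composition granted it. Concludes `Summit.HodgeConjecture.HodgeConjecture.Theses.NoetherLefschetzOneUp.K3TypeNets` BY NAME.
[cite: Arapura2022, Cor. 1.4 and Rmk. 1.6] [cite: Buskin2019, Thm. 1.1] -/
theorem K3TypeNets_of (h₁ : Registered.stub_pgZeroFactor) (h₂ : Registered.stub_k3Pairs)
    (h₃ : Registered.stub_residualPgOnePairs) (h₄ : Registered.stub_isogenySectorGrantedProducts)
    (h₅ : Registered.stub_nlRegularJumpingGrantedProducts)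
    (h₆ : Registered.stub_nlIrregularJumpingGrantedProducts) : K3TypeNets :=
  k3TypeNets_of_pgOneProductClasses h₄ h₅ h₆ (PgOneProductClasses_of h₁ h₂ h₃)

/-! ## §4 Wiring check -/

/-- The six stubs feed the composition VERBATIM (inherits the six `sorry`s; not a proof of the item). -/
theorem k3TypeNets_holds_of_stubs : K3TypeNets :=
  K3TypeNets_of stub_pgZeroFactor stub_k3Pairs stub_residualPgOnePairs stub_isogenySectorGrantedProducts
    stub_nlRegularJumpingGrantedProducts stub_nlIrregularJumpingGrantedProducts

end Summit.HodgeConjecture.HodgeConjecture.Cruxes.K3TypeNets.ProductSector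

end
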